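import Summits.Ventures.Crystal3D.Theorems.StickyWulffConstantGenericWallFloorStackWalkFrames
import Summits.Ventures.Crystal3D.Theorems.StickyWulffConstantGenericWallFloorWalkMoves
import HarnessLib

/-!
# The stack walk on the tree's kissing theorems: no `ExactOnly` row, payer within contact distance

HONEST FRAMING. Part of the venture `Summits/Ventures/Crystal3D` (cell `crystal3d-full`), helper
`--supports` the crux `GenericWallFloor` (stmt-Ventures-19480) of `route-Ventures-StickyWulffConstant`,
registered line `WallLedgerG`, open stub `stub_twoSlabAdhesion` (general fillings).  The stack walk of
`…StackWalk` run on 19480-p1's `walk_moves` (inputs `KissingGap δ` / `KissingClassification δ`, which ARE tree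
theorems at `δ = 5/2`: `kissingClassification_250`, GAP via `CapX2.noHole_0625`) instead of the E1 row C12-55:
the same moves, the same rise `≥ 3/8`, but the walker stops as soon as SOME ball within contact distance has at
most eleven contacts (the payer is that ball, shared by `≤ 13` stoppers) — insurance against the P₅ row.

* `oriented_of_star_cap` — a cap whose far slots are empty and whose closed vertex star of `−v` is occupied has
  the arrival direction positive: `⟪F v, n⟫ = √(2/3)` (an in-plane `v` would put a star ball on a far slot).
* `walk_dispatch_K` — certified walker ⇒ payer within distance `1`, or full, or oriented exact cap.
* `walkStep_spec_K`, `walkRun_spec_K`, **`stackWalk_end_K`** — as in `…StackWalk`.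

WHAT THIS IS NOT: not the stub; the payer is within contact distance (multiplicity `13` in the ledger);
F-C1 not moved.
-/

noncomputable section

namespace Summit.Ventures.Crystal3D.Theorems

open Finset
open scoped InnerProductSpace

variable {X : Finset (EuclideanSpace ℝ (Fin 3))}

/-! ### Orientation from the star -/

/-- **The arrival direction of a star-certified cap is positive.**  `F` a frame, `n` a unit menu normal whose
far slots at `y` are empty, `v` a slot whose closed vertex star about `−v` is occupied at `y`
(`y + F x ∈ X` whenever `⟪F x, F v⟫ < 0`).  Then `⟪F v, n⟫ = √(2/3)`. -/
theorem oriented_of_star_cap (F : EuclideanSpace ℝ (Fin 3) ≃ₗᵢ[ℝ] EuclideanSpace ℝ (Fin 3))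
    {n y v : EuclideanSpace ℝ (Fin 3)} (hn : ‖n‖ = 1)
    (hmenu : ∀ w ∈ fccSlots, ⟪F w, n⟫_ℝ = 0 ∨ ⟪F w, n⟫_ℝ = Real.sqrt (2 / 3) ∨ ⟪F w, n⟫_ℝ = -Real.sqrt (2 / 3))
    (hv : v ∈ fccSlots) (hstar : ∀ x ∈ fccSlots, ⟪F x, F v⟫_ℝ < 0 → y + F x ∈ X)
    (hfar : ∀ w ∈ fccSlots, 0 < ⟪F w, n⟫_ℝ → y + F w ∉ X) : ⟪F v, n⟫_ℝ = Real.sqrt (2 / 3) := by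
  have hrpos : 0 < Real.sqrt (2 / 3) := Real.sqrt_pos.2 (by norm_num)
  have hvv : ⟪F v, F v⟫_ℝ = 1 := by
    rw [real_inner_self_eq_norm_sq, LinearIsometryEquiv.norm_map, norm_eq_one_of_mem_fccSlots hv, one_pow]
  -- `−v` is occupied, hence not far
  have hneg : ⟪F v, n⟫_ℝ ≠ -Real.sqrt (2 / 3) := by
    intro h
    have hocc : y + F (-v) ∈ X := hstar (-v) (neg_mem_fccSlots hv) (by rw [map_neg, inner_neg_left, hvv]; norm_num)
    exact hfar (-v) (neg_mem_fccSlots hv) (by rw [map_neg, inner_neg_left, h, neg_neg]; exact hrpos) hocc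
  rcases hmenu v hv with h0 | hd | hm
  · exfalso
    -- the far frame sums to `√6 n`, so some far slot meets `v` negatively: a star ball on a far slot
    obtain ⟨p₁, hp₁, p₂, hp₂, p₃, hp₃, hn₁, hn₂, hn₃, h12, h13, h23, hind, -⟩ := exists_far_frame F hn hmenu
    have hu : ∀ {p}, p ∈ fccSlots → ‖F p‖ = 1 := fun hp => by
      rw [LinearIsometryEquiv.norm_map, norm_eq_one_of_mem_fccSlots hp]
    have hpair : ∀ {a b : EuclideanSpace ℝ (Fin 3)}, ⟪a, b⟫_ℝ = 1 / 2 → ⟪F a, F b⟫_ℝ = 1 / 2 :=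
      fun h => by rw [LinearIsometryEquiv.inner_map_map]; exact h
    have hsum := sum_eq_sqrt_six_smul (F p₁) (F p₂) (F p₃) n (hu hp₁) (hu hp₂) (hu hp₃) hn (hpair h12)
      (hpair h13) (hpair h23) hn₁ hn₂ hn₃
    have hsv : ⟪F p₁, F v⟫_ℝ + ⟪F p₂, F v⟫_ℝ + ⟪F p₃, F v⟫_ℝ = 0 := by
      rw [← inner_add_left, ← inner_add_left, hsum, inner_smul_left, real_inner_comm, h0]; simp
    have hnn : ∀ {p}, p ∈ fccSlots → ⟪F p, n⟫_ℝ = Real.sqrt (2 / 3) → 0 ≤ ⟪F p, F v⟫_ℝ := by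
      intro p hp hpn
      by_contra hlt
      push Not at hlt
      exact hfar p hp (by rw [hpn]; exact hrpos) (hstar p hp hlt)
    have e1 : ⟪F p₁, F v⟫_ℝ = 0 := by linarith [hnn hp₁ hn₁, hnn hp₂ hn₂, hnn hp₃ hn₃]
    have e2 : ⟪F p₂, F v⟫_ℝ = 0 := by linarith [hnn hp₁ hn₁, hnn hp₂ hn₂, hnn hp₃ hn₃]
    have e3 : ⟪F p₃, F v⟫_ℝ = 0 := by linarith [hnn hp₁ hn₁, hnn hp₂ hn₂, hnn hp₃ hn₃]
    rw [LinearIsometryEquiv.inner_map_map] at e1 e2 e3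
    have hv0 : v = 0 := eq_zero_of_inner_eq_zero_of_indep hind e1 e2 e3
    have := norm_eq_one_of_mem_fccSlots hv
    rw [hv0, norm_zero] at this; exact one_ne_zero this.symm
  · exact hd
  · exact absurd hm hneg

/-! ### The dispatch on the kissing theorems -/

/-- **Dispatch (kissing version).**  A certified walker at `y ∈ X` in a `1`-separated `X`: some ball within
contact distance of `y` has at most eleven contacts, OR `y` has a full `F`-shell, OR `y` is an exact cap of `F`
oriented along its direction. -/
theorem walk_dispatch_K {δ : ℝ} (hg : KissingGap δ) (hkc : KissingClassification δ)
    (hX : ∀ p ∈ X, ∀ q ∈ X, p ≠ q → 1 ≤ dist p q)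
    {y : EuclideanSpace ℝ (Fin 3)} (hyX : y ∈ X) {e : WalkEntry} (hdir : e.dir ∈ fccSlots)
    (hC : WalkCertified X y e) :
    (∃ q ∈ X, dist y q ≤ 1 ∧ (X.filter fun q' => dist q q' = 1).card ≤ 11) ∨
      (∀ w ∈ fccSlots, y + e.frame w ∈ X) ∨ ∃ n, IsOrientedCap X e.frame y e.dir n := by
  have hstar : ∀ x ∈ fccSlots, ⟪e.frame x, e.frame e.dir⟫_ℝ < 0 → y + e.frame x ∈ X := by
    intro x hx hlt
    rcases hC with ⟨hd, hsh⟩ | ⟨n₀, -, hmenu₀, hpos₀, hd, hocc₀⟩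
    · exact exit_owns_closedStar e.frame hdir hd hsh hx hlt
    · have := capper_owns_closedStar e.frame hmenu₀ hd hocc₀ hdir hpos₀ hx hlt
      rwa [sub_add_cancel] at this
  obtain ⟨a, ha, b, hb, c, hc, hind, haX, hbX, hcX⟩ := walkCertified_three_independent hdir hC
  rcases walk_moves hg hkc hX hyX e.frame ha hb hc hind haX hbX hcX with hpay | hfcc | htwin
  · exact Or.inl hpay
  · exact Or.inr (Or.inl fun w hw => (hfcc w hw).1)
  · obtain ⟨n, hn, hmenu, F', hF', hown, hmirror, hfar⟩ := htwin
    refine Or.inr (Or.inr ⟨n, hn, hmenu, oriented_of_star_cap e.frame hn hmenu hdir hstar hfar,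
      fun w hw hle => (hown w hw hle).1, fun w hw hpos => ⟨hfar w hw hpos, ?_⟩⟩)
    have hneg : ⟪e.frame (-w), n⟫_ℝ < 0 := by rw [map_neg, inner_neg_left]; linarith
    have hmem := (hmirror (-w) (neg_mem_fccSlots hw) hneg).1
    rw [hF'] at hmem
    have e1 : y + (e.frame (-w) - (2 * ⟪e.frame (-w), n⟫_ℝ) • n) = y - e.frame w + (2 * ⟪e.frame w, n⟫_ℝ) • n := by
      rw [map_neg, inner_neg_left]; module
    rwa [e1] at hmem

/-! ### One step -/

/-- **One step of the stack walk (kissing version).**  Under `WalkInv` the walker either stops next to a ball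
with at most eleven contacts (within contact distance `1`), or moves to a state satisfying `WalkInv` by a
unit vector rising by at least `3/8`.  Inputs `KissingGap δ`, `KissingClassification δ` (tree theorems at
`δ = 5/2`), NO `ExactOnly` row. -/
theorem walkStep_spec_K {δ : ℝ} (hg : KissingGap δ) (hkc : KissingClassification δ) (hX : ∀ p ∈ X, ∀ q ∈ X, p ≠ q → 1 ≤ dist p q)
    {z : EuclideanSpace ℝ (Fin 3)} (hz : ‖z‖ = 1)
    {s : EuclideanSpace ℝ (Fin 3) × List WalkEntry} (hInv : WalkInv X z s) :
    (walkStep X z s = none ∧ ∃ q ∈ X, dist s.1 q ≤ 1 ∧ (X.filter fun q' => dist q q' = 1).card ≤ 11) ∨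
    ∃ s', walkStep X z s = some s' ∧ WalkInv X z s' ∧ ‖s'.1 - s.1‖ = 1 ∧ (3 / 8 : ℝ) ≤ ⟪s'.1 - s.1, z⟫_ℝ := by
  classical
  obtain ⟨y, stk⟩ := s
  obtain ⟨hyX, hS, e, rest, hstk, hC⟩ := hInv
  simp only at hyX hS hstk hC ⊢
  subst hstk
  obtain ⟨hdir, hrise⟩ := hS.top
  set F := e.frame with hF
  set v := e.dir with hv
  have hrpos : 0 < Real.sqrt (2 / 3) := Real.sqrt_pos.2 (by norm_num)
  have hunit : ∀ (G : EuclideanSpace ℝ (Fin 3) ≃ₗᵢ[ℝ] EuclideanSpace ℝ (Fin 3)) {w : EuclideanSpace ℝ (Fin 3)},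
      w ∈ fccSlots → ‖G w‖ = 1 := fun G w hw => by rw [LinearIsometryEquiv.norm_map, norm_eq_one_of_mem_fccSlots hw]
  by_cases hfull : ∀ w ∈ fccSlots, y + F w ∈ X
  · -- FULL: straight on
    refine Or.inr ⟨(y + F v, e :: rest), walkStep_of_full X z y e rest hfull, ⟨hfull v hdir, hS, e, rest, rfl, ?_⟩,
      ?_, ?_⟩
    · left
      refine ⟨by simp [hF, hv, hyX], fun w hw => ?_⟩
      simp only [hF, hv, add_sub_cancel_right]; exact hfull w hw
    · simp only [add_sub_cancel_left]; exact hunit F hdir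
    · simp only [add_sub_cancel_left]; exact hrise
  by_cases hcap : ∃ n, IsOrientedCap X F y v n
  · -- CAP
    obtain ⟨n₁, hn₁def⟩ : ∃ n₁, n₁ = Classical.choose hcap := ⟨_, rfl⟩
    have hspec := Classical.choose_spec hcap
    rw [← hn₁def] at hspec
    obtain ⟨hn₁, hmenu₁, hvn₁, hle₁, hgt₁⟩ := hspec
    have hstep : walkStep X z (y, e :: rest) = some (capMove z y e rest n₁) := by
      rw [hn₁def]; exact walkStep_of_cap X z y e rest hfull hcap
    -- the height of the cap normal
    have hn1z : (1 / 7 : ℝ) ≤ ⟪n₁, z⟫_ℝ := by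
      cases rest with
      | nil =>
        obtain ⟨-, hsteep⟩ := hS
        exact inner_ge_seventh_of_steep_across (F v) n₁ z (hunit F hdir) hn₁ hz hvn₁ hsteep
      | cons e' rest' =>
        obtain ⟨⟨-, hm1, hmenum, hvm, hmz, -, hm2⟩, -, -⟩ := hS
        rcases menu_normal_eq_or_eq_twin F hm1 hn₁ (hunit F hdir) hmenum hmenu₁ hvm hvn₁ with h | h
        · rw [h]; exact hmz
        · rw [h, inner_sub_left, inner_smul_left]; simpa using hm2
    -- POP or PUSH
    by_cases hpop : ∃ e' rest', rest = e' :: rest' ∧ n₁ = e.nrm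
    · obtain ⟨e', rest', hrest, hne⟩ := hpop
      subst hrest
      obtain ⟨hSound, ⟨hlink, hum⟩, hS'⟩ := hS
      set G := e'.frame with hG
      set u := e'.dir with hu
      obtain ⟨hudir, hurise⟩ := hS'.top
      have hmove : capMove z y e (e' :: rest') n₁ = (y + G u, e' :: rest') := capMove_cons_of_eq z y e e' rest' hne
      rw [hmove] at hstep
      -- the frames: `F = R_m G`, so `G = R_m F` with `m = n₁`
      rw [← hne] at hlink hum
      have hGF : ∀ x, G x = F x - (2 * ⟪F x, n₁⟫_ℝ) • n₁ := twin_symm G F hn₁ hlink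
      have hoccG := occupied_nonneg_of_cap F G hn₁ hle₁ hgt₁ hGF
      have hmenuG := menu_reflect F G hn₁ hmenu₁ hGF
      have hupos : 0 < ⟪G u, n₁⟫_ℝ := by rw [hum]; exact hrpos
      refine Or.inr ⟨(y + G u, e' :: rest'), hstep, ⟨hoccG u hudir hupos.le, hS', e', rest', rfl, ?_⟩, ?_, ?_⟩
      · right
        refine ⟨n₁, hn₁, hmenuG, hupos, by simp [hG, hu, hyX], fun w hw hw0 => ?_⟩
        simp only [hG, hu, add_sub_cancel_right]; exact hoccG w hw hw0
      · simp only [add_sub_cancel_left]; exact hunit G hudir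
      · simp only [add_sub_cancel_left]; exact hurise
    · -- PUSH
      have hmove : capMove z y e rest n₁ = pushMove z y e rest n₁ := by
        cases rest with
        | nil => rfl
        | cons e' rest' =>
          have hne : n₁ ≠ e.nrm := fun h => hpop ⟨e', rest', rfl, h⟩
          exact capMove_cons_of_ne z y e e' rest' hne
      rw [hmove] at hstep
      set F' := twinFrame F n₁ with hF'
      have hF'x : ∀ x, F' x = F x - (2 * ⟪F x, n₁⟫_ℝ) • n₁ := fun x => twinFrame_apply F hn₁ x
      have hflip : ∀ x, ⟪F' x, n₁⟫_ℝ = -⟪F x, n₁⟫_ℝ := inner_twin_eq_neg F F' hn₁ hF'x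
      have hmenu' := menu_reflect F F' hn₁ hmenu₁ hF'x
      have hocc' := occupied_nonneg_of_cap F F' hn₁ hle₁ hgt₁ hF'x
      -- the positive slots of `F'` and the best capper
      set S := fccSlots.filter fun q => 0 < ⟪F' q, n₁⟫_ℝ with hSdef
      have hSne : S.Nonempty := by
        refine ⟨-v, Finset.mem_filter.2 ⟨neg_mem_fccSlots hdir, ?_⟩⟩
        rw [map_neg, inner_neg_left, hflip, hvn₁, neg_neg]; exact hrpos
      obtain ⟨hqS, hqmax⟩ := bestCapper_spec F' n₁ z hSne
      set q := bestCapper F' n₁ z with hq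
      obtain ⟨hqdir, hqpos⟩ := Finset.mem_filter.1 hqS
      have hqn : ⟪F' q, n₁⟫_ℝ = Real.sqrt (2 / 3) := by
        rcases hmenu' q hqdir with h | h | h
        · rw [h] at hqpos; exact absurd hqpos (lt_irrefl 0)
        · exact h
        · rw [h] at hqpos; linarith
      -- the far frame of `n₁` in `F'` and the sharp rise bound
      obtain ⟨q₁, hq₁, q₂, hq₂, q₃, hq₃, hn1, hn2, hn3, h12, h13, h23, -, hexh⟩ := exists_far_frame F' hn₁ hmenu'
      have hle_of : ∀ {q'}, q' ∈ fccSlots → ⟪F' q', n₁⟫_ℝ = Real.sqrt (2 / 3) → ⟪F' q', z⟫_ℝ ≤ ⟪F' q, z⟫_ℝ :=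
        fun {q'} hq' hq'n => hqmax q' (Finset.mem_filter.2 ⟨hq', by rw [hq'n]; exact hrpos⟩)
      have hMeq : ⟪F' q, z⟫_ℝ = ⟪F' q₁, z⟫_ℝ ∨ ⟪F' q, z⟫_ℝ = ⟪F' q₂, z⟫_ℝ ∨ ⟪F' q, z⟫_ℝ = ⟪F' q₃, z⟫_ℝ := by
        rcases hexh q hqdir hqpos with h | h | h
        · left; rw [h]
        · right; left; rw [h]
        · right; right; rw [h]
      have hpair : ∀ {a b : EuclideanSpace ℝ (Fin 3)}, ⟪a, b⟫_ℝ = 1 / 2 → ⟪F' a, F' b⟫_ℝ = 1 / 2 :=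
        fun h => by rw [LinearIsometryEquiv.inner_map_map]; exact h
      obtain ⟨hM, hM2⟩ := best_capper_bounds (hunit F' hq₁) (hunit F' hq₂) (hunit F' hq₃) hn₁ hz
        (hpair h12) (hpair h13) (hpair h23) hn1 hn2 hn3 hn1z (hle_of hq₁ hn1) (hle_of hq₂ hn2) (hle_of hq₃ hn3) hMeq
      have hpush : pushMove z y e rest n₁ = (y + F' q, ⟨F', q, n₁⟩ :: e :: rest) := rfl
      rw [hpush] at hstep
      refine Or.inr ⟨(y + F' q, ⟨F', q, n₁⟩ :: e :: rest), hstep,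
        ⟨hocc' q hqdir hqpos.le, ?_, ⟨F', q, n₁⟩, e :: rest, rfl, ?_⟩, ?_, ?_⟩
      · -- the new stack is sound
        show StackSound z (⟨F', q, n₁⟩ :: e :: rest)
        exact ⟨⟨hqdir, hn₁, hmenu', hqn, hn1z, hM, hM2⟩, ⟨hF'x, hvn₁⟩, hS⟩
      · right
        refine ⟨n₁, hn₁, hmenu', hqpos, by simp [hyX], fun w hw hw0 => ?_⟩
        simp only [add_sub_cancel_right]; exact hocc' w hw hw0
      · simp only [add_sub_cancel_left]; exact hunit F' hqdir
      · simp only [add_sub_cancel_left]; exact hM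
  · -- STOP: a ball within contact distance pays
    refine Or.inl ⟨walkStep_of_stop X z y e rest hfull hcap, ?_⟩
    rcases walk_dispatch_K hg hkc hX hyX hdir hC with hpay | hall | hc
    · exact hpay
    · exact absurd hall hfull
    · exact absurd hc hcap

/-! ### The run -/

/-- **The run (kissing version).** -/
theorem walkRun_spec_K {δ : ℝ} (hg : KissingGap δ) (hkc : KissingClassification δ) (hX : ∀ p ∈ X, ∀ q ∈ X, p ≠ q → 1 ≤ dist p q)
    {z : EuclideanSpace ℝ (Fin 3)} (hz : ‖z‖ = 1) :
    ∀ (k : ℕ) (s : EuclideanSpace ℝ (Fin 3) × List WalkEntry), WalkInv X z s →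
      WalkInv X z (walkRun X z k s) ∧
      ‖(walkRun X z k s).1 - s.1‖ ≤ 8 / 3 * ⟪(walkRun X z k s).1 - s.1, z⟫_ℝ ∧
      (walkStep X z (walkRun X z k s) ≠ none → (3 / 8 : ℝ) * k ≤ ⟪(walkRun X z k s).1 - s.1, z⟫_ℝ)
  | 0, s, hInv => by simp [hInv]
  | k + 1, s, hInv => by
    rcases walkStep_spec_K hg hkc hX hz hInv with ⟨hnone, -⟩ | ⟨s', hsome, hInv', hnorm, hrise⟩
    · rw [walkRun_succ_of_none X z k hnone]
      refine ⟨hInv, by simp, fun h => absurd hnone h⟩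
    · rw [walkRun_succ_of_some X z k hsome]
      obtain ⟨hI, hdisp, hcount⟩ := walkRun_spec_K hg hkc hX hz k s' hInv'
      have hsplit : ⟪(walkRun X z k s').1 - s.1, z⟫_ℝ =
          ⟪(walkRun X z k s').1 - s'.1, z⟫_ℝ + ⟪s'.1 - s.1, z⟫_ℝ := by
        rw [← inner_add_left]; congr 1; abel
      have htri : ‖(walkRun X z k s').1 - s.1‖ ≤ ‖(walkRun X z k s').1 - s'.1‖ + ‖s'.1 - s.1‖ :=
        norm_sub_le_norm_sub_add_norm_sub _ _ _
      refine ⟨hI, ?_, fun h => ?_⟩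
      · rw [hnorm] at htri
        rw [hsplit]
        linarith
      · have := hcount h
        rw [hsplit]
        push_cast at this ⊢
        linarith

/-- **The stack walk pays (kissing version)**: with enough fuel the walk has stopped at a ball of `X` with a
ball of at most eleven contacts within contact distance; rise `≥ 0`, displacement `≤ (8/3)·rise`. -/
theorem stackWalk_end_K {δ : ℝ} (hg : KissingGap δ) (hkc : KissingClassification δ) (hX : ∀ p ∈ X, ∀ q ∈ X, p ≠ q → 1 ≤ dist p q)
    {z : EuclideanSpace ℝ (Fin 3)} (hz : ‖z‖ = 1) {H : ℝ} (hH : ∀ p ∈ X, ⟪p, z⟫_ℝ ≤ H)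
    {s : EuclideanSpace ℝ (Fin 3) × List WalkEntry} (hInv : WalkInv X z s)
    {N : ℕ} (hN : 8 * (H - ⟪s.1, z⟫_ℝ) < 3 * N) :
    (walkRun X z N s).1 ∈ X ∧
      (∃ q ∈ X, dist (walkRun X z N s).1 q ≤ 1 ∧ (X.filter fun q' => dist q q' = 1).card ≤ 11) ∧
      0 ≤ ⟪(walkRun X z N s).1 - s.1, z⟫_ℝ ∧
      ‖(walkRun X z N s).1 - s.1‖ ≤ 8 / 3 * ⟪(walkRun X z N s).1 - s.1, z⟫_ℝ ∧
      WalkInv X z (walkRun X z N s) ∧ walkStep X z (walkRun X z N s) = none := by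
  obtain ⟨hI, hdisp, hcount⟩ := walkRun_spec_K hg hkc hX hz N s hInv
  have hyX : (walkRun X z N s).1 ∈ X := hI.1
  -- the walk has stopped
  have hstop : walkStep X z (walkRun X z N s) = none := by
    by_contra h
    have h1 := hcount h
    have h2 : ⟪(walkRun X z N s).1 - s.1, z⟫_ℝ ≤ H - ⟪s.1, z⟫_ℝ := by
      rw [inner_sub_left]; linarith [hH _ hyX]
    linarith
  have hnonneg : 0 ≤ ⟪(walkRun X z N s).1 - s.1, z⟫_ℝ := by nlinarith [norm_nonneg ((walkRun X z N s).1 - s.1)]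
  refine ⟨hyX, ?_, hnonneg, hdisp, hI, hstop⟩
  -- the stopped ball pays
  obtain ⟨-, hS, e, rest, hstk, hC⟩ := hI
  have hstop' : walkStep X z ((walkRun X z N s).1, e :: rest) = none := by
    have : walkRun X z N s = ((walkRun X z N s).1, (walkRun X z N s).2) := rfl
    rw [this, hstk] at hstop; exact hstop
  obtain ⟨hnf, hnc⟩ := not_full_not_cap_of_walkStep_eq_none X z _ e rest hstop'
  rw [hstk] at hS
  rcases walk_dispatch_K hg hkc hX hyX hS.top.1 hC with hpay | hall | hc
  · exact hpay
  · exact absurd hall hnf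
  · exact absurd hc hnc

end Summit.Ventures.Crystal3D.Theorems

end
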